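import Literature.Analysis.FluidPDE.LeiRenZhang2019Plateau
import Literature.Analysis.FluidPDE.LeiRenZhang2019SwirlVanishing
import Literature.Analysis.FluidPDE.KNSSThm53OfWindow
import Literature.Analysis.FluidPDE.KNSSThm52SliceBridge
import Literature.Analysis.FluidPDE.SelfSimilarLiouville
import HarnessLib

/-!
# Lei–Ren–Zhang 2019, Theorem 1.2 (Liouville theorem under the rate condition on the swirl): proof

Analysis/FluidPDE proofs file (everything proved; no definitions, no named facts) discharging the
named fact `Literature.Analysis.FluidPDE.leiRenZhang2019_liouville_swirl_rate`
(`SelfSimilarLiouville`; Z. Lei, X. Ren, Q. S. Zhang, *On ancient periodic solutions to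
axially-symmetric Navier–Stokes equations*, arXiv:1902.11229, **Theorem 1.2**, p. 4 — published
as *Liouville type theorems for axially symmetric Navier–Stokes equations*, Sci. Sin. Math. 51
(2021) 971–984 —: "Let `v` be a bounded mild ancient solution to the ASNS such that `Γ = r v_θ` is
bounded. There exists a small number `ε₀ ∈ (0, 1)`, depending only on `‖v‖_∞`, such that if
`|Γ² − lim sup_{r→∞} Γ²| ≤ (ε₀/r) lim sup Γ²` holds uniformly for `z`, `t`, and large `r`, then
`v = c e_z`"):

* `leiRenZhang2019_liouville_swirl_rate_holds : leiRenZhang2019_liouville_swirl_rate`.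

## The proof (§4 of the source, pp. 10–12, in the tree's vocabulary)

Let `u` be a bounded ancient mild solution in the tree's duality form, `‖u‖ ≤ M`, with measurable
axisymmetric slices, bounded swirl `Γ = swirl (u t)`, and the rate condition
`|Γ² − L²| ≤ ε₀ L²/r` on `{r ≥ R₀}` (all `t < 0`).

1. **Class bridge** (`exists_jointly_measurable_axial_modification`, the construction of
   `knss_axisymmetric_no_swirl_of_KNSS2009` in `KNSSThm52SliceBridge`): up to a slice-wise axial
   drift `e(t) e_z` (invisible to the swirl, to the radial velocity and to axisymmetry) `u` has a
   jointly measurable modification `ũ` in the same class, hence a bounded weak solution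
   (`IsBoundedAncientMildSolution.isBoundedWeakNSSolutionOn`).
2. **Regularity** (KNSS 2009, §4 with the swirl equation (5.10), the tree's theorem
   `KNSS2009_regularity_axisymmetric_swirl_holds`): `ũ = U + β(t) e_z` a.e. with `U` smooth,
   axisymmetric, all derivatives bounded and Lipschitz in time, and `Γ = swirl (U t)` solving
   (5.10) off the axis with the bounded drift `U + β e_z`, whose radial component is that of `u`,
   bounded by `M`. The hypotheses on the swirl pass to the continuous representative
   (`leiRenZhang2019_boundedWeak_swirl_free`, the theorem in KNSS's class of bounded weak solutions).
3. **`L = 0`**: `Γ = 0` on `{r > R₀}`, hence `Γ ≡ 0` (`LRZPair.eq_zero_of_vanish_far`, KNSS's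
   Lemma 2.1; in print Lei–Zhang–Zhao's Remark 1.4).
4. **`L ≠ 0`** is impossible (the heart of §4): `Γ² ≥ L²/2` far out, so `Γ` has a sign there
   (`LRZPair.pos_or_neg_of_sq_ge`) and `|±Γ − |L|| ≤ ε₀|L|/r`; rescaling `x → r₀ x`, `t → r₀² t`
   (KNSS (5.11)–(5.13), which multiplies the radial drift bound `M` by `r₀` and divides the plateau
   width by `r₀`) puts the plateau `|F − |L|| ≤ ε₀|L|/r₀` on the unit annulus, and
   `LRZPair.false_of_plateau` (the weighted identity of §4 in the linear form of KNSS (5.15)–(5.20))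
   gives a contradiction as soon as `ε₀ (2C_S + C_S M + C_Δ) < 1` — this is the choice
   `ε₀ = ε₀(‖v‖_∞)` of the theorem; `C_S`, `C_Δ` are universal constants of the cut-off.
5. So `Γ ≡ 0`: `ũ` is swirl-free, KNSS's Theorem 5.2 (the tree's theorem
   `KNSS2009_liouville_axisymmetric_no_swirl_holds`) makes its slices `b(t) e_z` for a.e. `t`,
   and the continuity of the solenoidal pairings upgrades this to every slice of `u`
   (`IsBoundedAncientMildSolution.exists_ae_eq_const_slice`, `eq_smul_eZ_of_ae_eq_const_of_isAxisymmetric`).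

**Deviation from the printed proof, documented.** In print the rate hypothesis enters only the
term `I₁` (p. 11), the far region being handled by an auxiliary backward parabolic problem `φ₂`
(p. 10) and the observation `lim sup |Γ| = sup |Γ|`; with the hypothesis available on all of
`{r ≥ R₀}` (as in the statement of Theorem 1.2 and in the tree's rendering) the explicit cut-off
`ξ(r/r₀) η(z) ζ(t)` suffices and those two steps are not needed; the final appeal to
Lei–Zhang–Zhao's Remark 1.4 (`leiZhangZhao2017_liouville_swirl_decay`, a named fact of the tree) is
replaced by the Lemma 2.1 argument of step 3, so that no named fact is used.

## References

* Z. Lei, X. Ren, Q. S. Zhang, arXiv:1902.11229, Theorem 1.2 (p. 4) and §4 (pp. 10–12).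
  [LeiRenZhang2019]
* G. Koch, N. Nadirashvili, G. Seregin, V. Šverák, Acta Math. 203 (2009) = arXiv:0709.3599, §4,
  Lemma 2.1, Theorem 5.2 and the proof of Theorem 5.3. [KochNadirashviliSereginSverak2009]
* Z. Lei, Q. S. Zhang, N. Zhao, arXiv:1701.00868, Remark 1.4, Lemma 5.2. [LeiZhangZhao2017]
-/

noncomputable section

open MeasureTheory Set Function Filter Topology TopologicalSpace InnerProductSpace WithLp Metric
open scoped RealInnerProductSpace NNReal ENNReal ContDiff Laplacian

namespace Literature.Analysis.FluidPDE

/-! ### The class bridge: a jointly measurable modification up to an axial drift -/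

section Bridge

/-- **A bounded ancient mild solution with measurable axisymmetric slices has, up to a slice-wise
axial drift, a jointly measurable modification in the same class** (the construction of the
tree's `knss_axisymmetric_no_swirl_of_KNSS2009`, steps (1)–(4) of its docstring, extracted
verbatim: subtract the axial average `c(t) e_z`, take the jointly measurable modification `w` of
`AncientMildModification`, and put back a *measurable* drift `ct(t) e_z` with the drift lemma of
`AncientMildDrift`): there are `ũ` and `e : ℝ → ℝ` with `ũ` a bounded ancient mild solution
(`ν = 1`), jointly a.e. strongly measurable on `(−∞, 0) × ℝ³`, with measurable slices, and
`ũ(t) = u(t) + e(t) e_z` a.e. for every `t < 0`. [cite: KochNadirashviliSereginSverak2009, Thm 5.2 (arXiv pp. 9–10) with §1 p. 3 and §3 p. 7 (the constant b(t))] -/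
theorem exists_jointly_measurable_axial_modification
    {u : ℝ → EuclideanSpace ℝ (Fin 3) → EuclideanSpace ℝ (Fin 3)}
    (hu : IsBoundedAncientMildSolution 1 u) (hmeas : ∀ t < 0, AEStronglyMeasurable (u t) volume)
    (haxi : ∀ t < 0, IsAxisymmetric (u t)) :
    ∃ (ũ : ℝ → EuclideanSpace ℝ (Fin 3) → EuclideanSpace ℝ (Fin 3)) (e : ℝ → ℝ),
      IsBoundedAncientMildSolution 1 ũ ∧
      AEStronglyMeasurable (uncurry ũ)
        ((volume : Measure (ℝ × EuclideanSpace ℝ (Fin 3))).restrict (Iio 0 ×ˢ univ)) ∧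
      (∀ t < 0, AEStronglyMeasurable (ũ t) volume) ∧
      (∀ t < 0, ũ t =ᵐ[volume] fun x => u t x + e t • eZ) := by
  obtain ⟨M, hM'⟩ := hu.2
  have hM : ∀ t < 0, ∀ x, ‖u t x‖ ≤ M := fun t ht x => hM' t ht x
  have hM0 : 0 ≤ M := (norm_nonneg _).trans (hM (-1) (by norm_num) 0)
  have hν : (0 : ℝ) < 1 := one_pos
  -- (i) a radial weight and the axial average `c t e_z`
  obtain ⟨g, hg, hg0, hg1, hgrad⟩ := exists_radial_test_weight (E := EuclideanSpace ℝ (Fin 3))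
  have hgc : Continuous g := hg.contDiff.continuous
  have hgi : Integrable g := hgc.integrable_of_hasCompactSupport hg.hasCompactSupport
  have hgrot : ∀ y, g (rotZ Real.pi y) = g y := fun y => hgrad _ _ (norm_rotZ _ _)
  set c : ℝ → ℝ := fun t => ∫ y, g y * u t y 2 with hc_def
  have havg : ∀ t < 0, ∫ y, g y • u t y = c t • eZ := fun t ht =>
    integral_smul_eq_smul_eZ_of_isAxisymmetric hgi hgrot (haxi t ht) (hmeas t ht) (hM t ht)
  have hcb : ∀ t < 0, |c t| ≤ M := by
    intro t ht
    have hint : Integrable fun y => g y * u t y 2 :=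
      Integrable.mono' (hgi.norm.mul_const M) (hgi.aestronglyMeasurable.mul
        ((EuclideanSpace.proj (2 : Fin 3)).continuous.comp_aestronglyMeasurable (hmeas t ht)))
        (Eventually.of_forall fun y => by
          rw [norm_mul]
          refine mul_le_mul_of_nonneg_left ?_ (norm_nonneg _)
          exact (by simpa using PiLp.norm_apply_le (u t y) 2 : ‖u t y 2‖ ≤ ‖u t y‖).trans (hM t ht y))
    calc |c t| = ‖∫ y, g y * u t y 2‖ := (Real.norm_eq_abs _).symm
      _ ≤ ∫ y, ‖g y‖ * M := norm_integral_le_of_norm_le (hgi.norm.mul_const M) (Eventually.of_forall fun y => by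
          rw [norm_mul]
          refine mul_le_mul_of_nonneg_left ?_ (norm_nonneg _)
          exact (by simpa using PiLp.norm_apply_le (u t y) 2 : ‖u t y 2‖ ≤ ‖u t y‖).trans (hM t ht y))
      _ = M := by
          rw [integral_mul_const]
          have : ∫ y, ‖g y‖ = 1 := by
            rw [← hg1]
            exact integral_congr_ae (Eventually.of_forall fun y => Real.norm_of_nonneg (hg0 y))
          rw [this, one_mul]
  -- (ii) the jointly measurable modification `w`, `u t = w t + c t e_z` a.e.
  obtain ⟨w, hw, ⟨B, hwB⟩, hwu⟩ :=
    hu.exists_modification_sub_average hν hmeas hgc hg.hasCompactSupport hg1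
  have hwu' : ∀ t < 0, w t =ᵐ[volume] fun x => u t x - c t • eZ := fun t ht =>
    (hwu t ht).trans (Eventually.of_forall fun x => by simp only [havg t ht])
  have huw : ∀ t < 0, u t =ᵐ[volume] fun x => w t x + c t • eZ := fun t ht => by
    filter_upwards [hwu' t ht] with x hx
    rw [hx, sub_add_cancel]
  have hwm : ∀ t, AEStronglyMeasurable (w t) volume := fun t =>
    (hw.comp_measurable measurable_prodMk_left).aestronglyMeasurable
  have hwdiv : ∀ t < 0, IsWeaklyDivFree (w t) := fun t ht =>
    isWeaklyDivFree_of_ae_eq_add_const (hu.1.1 t ht) (hmeas t ht) (hM t ht) (-(c t • eZ))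
      ((hwu' t ht).trans (Eventually.of_forall fun x => by simp only [sub_eq_add_neg]))
  -- (iii) `u' = w + c e_z`, a.e. equal to `u` slice-wise
  set u' : ℝ → EuclideanSpace ℝ (Fin 3) → EuclideanSpace ℝ (Fin 3) := fun t x => w t x + c t • eZ with hu'_def
  have hu'u : ∀ t < 0, u' t =ᵐ[volume] u t := fun t ht => (huw t ht).symm
  have heZ : ‖(eZ : EuclideanSpace ℝ (Fin 3))‖ = 1 := by simp [eZ]
  have hu'M : ∀ t < 0, ∀ x, ‖u' t x‖ ≤ B + M := fun t ht x =>
    (norm_add_le _ _).trans (add_le_add (hwB t x) (by rw [norm_smul, heZ, mul_one, Real.norm_eq_abs]; exact hcb t ht))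
  have hu'sol : IsBoundedAncientMildSolution 1 u' := hu.congr_ae_slice hu'u ⟨B + M, fun t ht x => hu'M t ht x⟩
  have hu'meas : ∀ t < 0, AEStronglyMeasurable (u' t) volume := fun t _ => (hwm t).add aestronglyMeasurable_const
  -- (v) a countable dense family of solenoidal tests; the cross terms `m` and their zero sets
  obtain ⟨φs, hφs, hdense⟩ := exists_seq_isDivFree_dense (E := EuclideanSpace ℝ (Fin 3))
  have hm_meas : ∀ (q : ℝ) (k : ℕ), Measurable fun τ =>
      ∫ x, ⟪w τ x, fderiv ℝ (heatTest 1 (φs k) (q - τ)) x eZ⟫ := fun q k =>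
    measurable_integral_inner_fderiv_heatTest_apply hw (hφs k).1 1 q eZ
  -- honest rational final times: non-constant slices
  set H : Set ℚ := {q | (q : ℝ) < 0 ∧ ∀ κ : EuclideanSpace ℝ (Fin 3), ¬ (u q =ᵐ[volume] fun _ => κ)} with hH_def
  set A : ℚ → ℕ → Set ℝ := fun q k =>
    {τ | τ < q ∧ (∫ x, ⟪w τ x, fderiv ℝ (heatTest 1 (φs k) (q - τ)) x eZ⟫) ≠ 0} with hA_def
  have hAm : ∀ q k, MeasurableSet (A q k) := fun q k =>
    measurableSet_Iio.inter ((hm_meas q k) (measurableSet_singleton (0 : ℝ)).compl)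
  set Gd : Set ℝ := ⋃ p : H × ℕ, A p.1 p.2 with hGd_def
  have hGm : MeasurableSet Gd := MeasurableSet.iUnion fun p => hAm _ _
  have hGd0 : Gd ⊆ Iio 0 := by
    intro τ hτ
    obtain ⟨p, hp⟩ := mem_iUnion.1 hτ
    exact lt_trans hp.1 p.1.2.1
  -- (iv)+(vii) `c` is a.e. measurable on `Gd`
  have hcA : ∀ (q : H) (k : ℕ), AEMeasurable c (volume.restrict (A q k)) := by
    intro q k
    have hq0 : ((q : ℚ) : ℝ) < 0 := q.2.1
    set qr : ℝ := ((q : ℚ) : ℝ) with hqr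
    -- the three functions of `τ`
    set Gf : ℝ → ℝ := fun τ => ∫ x, ⟪u τ x, convect (u τ) (heatTest 1 (φs k) (qr - τ)) x⟫ with hGf
    set Nf : ℝ → ℝ := fun τ => ∫ x, ⟪w τ x, fderiv ℝ (heatTest 1 (φs k) (qr - τ)) x (w τ x)⟫ with hNf
    set mf : ℝ → ℝ := fun τ => ∫ x, ⟪w τ x, fderiv ℝ (heatTest 1 (φs k) (qr - τ)) x eZ⟫ with hmf
    have hNm : Measurable Nf := measurable_integral_inner_fderiv_heatTest_self hw (hφs k).1 1 qr
    have hmm : Measurable mf := hm_meas qr k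
    -- the splitting `G = N + c m` at every `τ < 0`
    have hsplit : ∀ τ < 0, Gf τ = Nf τ + c τ * mf τ := by
      intro τ hτ
      have e1 : Gf τ = ∫ x, ⟪u' τ x, convect (u' τ) (heatTest 1 (φs k) (qr - τ)) x⟫ :=
        integral_inner_convect_heatTest_congr_ae (huw τ hτ) _
      rw [e1]
      simpa only [hu'_def, hNf, hmf, convect_apply] using
        integral_inner_convect_heatTest_add_const (hwm τ) (hwB τ) (hwdiv τ hτ) (c τ) eZ (hφs k).1 1 (qr - τ)
    -- honesty at `q`: `G` is integrable on every `(s, q)`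
    have hGint : ∀ s < qr, IntervalIntegrable Gf volume s qr := fun s hs =>
      hu.intervalIntegrable_nonlinear_of_not_ae_const hν hmeas hq0 q.2.2 hs (hφs k).1 (hφs k).2
    -- `c m = G - N` is a.e. measurable on every `(s, q)`, hence on `Iio q`
    have hcm_s : ∀ s < qr, AEMeasurable (fun τ => c τ * mf τ) (volume.restrict (Ioo s qr)) := by
      intro s hs
      have hGae : AEMeasurable Gf (volume.restrict (Ioo s qr)) :=
        ((hGint s hs).def'.mono_set (by rw [uIoc_of_le hs.le]; exact Ioo_subset_Ioc_self)).aestronglyMeasurable.aemeasurable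
      refine (hGae.sub hNm.aemeasurable).congr ?_
      refine (ae_restrict_mem measurableSet_Ioo).mono fun τ hτ => ?_
      have hτ0 : τ < 0 := hτ.2.trans hq0
      show Gf τ - Nf τ = c τ * mf τ
      rw [hsplit τ hτ0]
      ring
    have hcm : AEMeasurable (fun τ => c τ * mf τ) (volume.restrict (Iio qr)) := by
      have hcover : Iio qr = ⋃ n : ℕ, Ioo (qr - ((n : ℝ) + 1)) qr := by
        ext τ
        simp only [mem_Iio, mem_iUnion, mem_Ioo]
        constructor
        · intro hτ
          obtain ⟨n, hn⟩ := exists_nat_gt (qr - τ)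
          exact ⟨n, by linarith, hτ⟩
        · rintro ⟨n, -, hn2⟩
          exact hn2
      rw [hcover]
      exact aemeasurable_iUnion_iff.2 fun n => hcm_s _ (by linarith)
    -- on `A q k`, `m ≠ 0` and `c = (c m) / m`
    have hAsub : A q k ⊆ Iio qr := fun τ hτ => hτ.1
    have hcmA : AEMeasurable (fun τ => c τ * mf τ) (volume.restrict (A q k)) :=
      hcm.mono_measure (Measure.restrict_mono hAsub le_rfl)
    refine ((hcmA.div hmm.aemeasurable).congr ?_)
    refine (ae_restrict_mem (hAm q k)).mono fun τ hτ => ?_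
    show c τ * mf τ / mf τ = c τ
    exact mul_div_cancel_right₀ _ hτ.2
  have hcG : AEMeasurable c (volume.restrict Gd) := aemeasurable_iUnion_iff.2 fun p => hcA p.1 p.2
  -- the measurable, bounded substitute `ct` of `c`: `ct = c` a.e. on `Gd`, `ct = 0` off `Gd`
  set c₁ : ℝ → ℝ := hcG.mk c with hc₁_def
  have hc₁m : Measurable c₁ := hcG.measurable_mk
  have hcc₁ : ∀ᵐ τ ∂(volume.restrict Gd), c τ = c₁ τ := hcG.ae_eq_mk
  set ct : ℝ → ℝ := Gd.indicator fun τ => max (-M) (min M (c₁ τ)) with hct_def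
  have hctm : Measurable ct := (measurable_const.max (measurable_const.min hc₁m)).indicator hGm
  have hclip : ∀ y : ℝ, |max (-M) (min M y)| ≤ M := fun y =>
    abs_le.2 ⟨le_max_left _ _, max_le (by linarith) (min_le_left _ _)⟩
  have hctb : ∀ τ, |ct τ| ≤ M := by
    intro τ
    by_cases hτ : τ ∈ Gd
    · rw [hct_def, indicator_of_mem hτ]; exact hclip _
    · rw [hct_def, indicator_of_notMem hτ, abs_zero]; exact hM0
  have hct_on : ∀ᵐ τ ∂(volume : Measure ℝ), τ ∈ Gd → ct τ = c τ := by
    have h1 : ∀ᵐ τ ∂(volume : Measure ℝ), τ ∈ Gd → c τ = c₁ τ := (ae_restrict_iff' hGm).1 hcc₁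
    filter_upwards [h1] with τ hτ hmem
    have hc0 : |c τ| ≤ M := hcb τ (hGd0 hmem)
    rw [hct_def, indicator_of_mem hmem, ← hτ hmem]
    rw [abs_le] at hc0
    rw [min_eq_right hc0.2, max_eq_right hc0.1]
  -- (viii) off `Gd` the slices are invariant under the vertical translations
  have hinv_off : ∀ τ < 0, τ ∉ Gd → ∀ h : ℝ,
      (fun x => u τ (x + h • eZ)) =ᵐ[volume] u τ := by
    intro τ hτ hτG
    refine ae_eq_comp_add_smul_of_forall_integral_inner_fderiv_eq_zero (hmeas τ hτ) (hM τ hτ) (hu.1.1 τ hτ)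
      (fun φ hφ hdivφ => ?_)
    have hφ1 : ContDiff ℝ 1 φ := hφ.contDiff.of_le (by exact_mod_cast le_top)
    by_cases hacc : ∀ ε > (0 : ℝ), ∃ q : ℚ, q ∈ H ∧ τ < q ∧ (q : ℝ) < τ + ε
    · -- honest rational final times accumulate at `τ⁺`
      choose q hqH hτq hqε using fun n : ℕ => hacc (1 / ((n : ℝ) + 1)) (by positivity)
      have hσpos : ∀ n, 0 < (q n : ℝ) - τ := fun n => sub_pos.2 (hτq n)
      have hσ : Tendsto (fun n => (q n : ℝ) - τ) atTop (𝓝 0) := by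
        refine squeeze_zero (fun n => (hσpos n).le) (fun n => ?_) tendsto_one_div_add_atTop_nhds_zero_nat
        linarith [hqε n]
      -- `m^{qₙ}_k(τ) = 0`: otherwise `τ ∈ Gd`
      have hm0 : ∀ n k, ∫ x, ⟪w τ x, fderiv ℝ (heatTest 1 (φs k) ((q n : ℝ) - τ)) x eZ⟫ = 0 := by
        intro n k
        by_contra hne
        exact hτG (mem_iUnion.2 ⟨⟨⟨q n, hqH n⟩, k⟩, hτq n, hne⟩)
      -- transfer from `w τ` to `u τ = w τ + c τ e_z`
      have htrans : ∀ ψ : EuclideanSpace ℝ (Fin 3) → EuclideanSpace ℝ (Fin 3),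
          FunctionSpaces.IsTestFunctionOn (⊤ : Opens (EuclideanSpace ℝ (Fin 3))) ψ → ∀ σ : ℝ,
          ∫ x, ⟪u τ x, fderiv ℝ (heatTest 1 ψ σ) x eZ⟫ = ∫ x, ⟪w τ x, fderiv ℝ (heatTest 1 ψ σ) x eZ⟫ := by
        intro ψ hψ σ
        have hψ1 : ContDiff ℝ 1 ψ := hψ.contDiff.of_le (by exact_mod_cast le_top)
        have hDc : Continuous fun z => fderiv ℝ ψ z eZ := (hψ1.continuous_fderiv one_ne_zero).clm_apply continuous_const
        have hDi : Integrable fun x => fderiv ℝ (heatTest 1 ψ σ) x eZ := by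
          have : Integrable (heatFlow (fun z => fderiv ℝ ψ z eZ) (1 * σ)) :=
            integrable_heatFlow (hDc.integrable_of_hasCompactSupport (hψ.hasCompactSupport.fderiv_apply (𝕜 := ℝ) eZ)) _
          exact this.congr (Eventually.of_forall fun x => (fderiv_heatFlow_apply hψ1 hψ.hasCompactSupport _ x eZ).symm)
        have i1 : Integrable fun x => ⟪w τ x, fderiv ℝ (heatTest 1 ψ σ) x eZ⟫ :=
          integrable_inner_of_aestronglyMeasurable_of_norm_le (hwm τ) (hwB τ) hDi
        have i2 : Integrable fun x => ⟪c τ • eZ, fderiv ℝ (heatTest 1 ψ σ) x eZ⟫ := hDi.const_inner _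
        have h0 : ∫ x, ⟪c τ • eZ, fderiv ℝ (heatTest 1 ψ σ) x eZ⟫ = 0 :=
          integral_inner_const_fderiv_heatFlow_eq_zero hψ1 hψ.hasCompactSupport (1 * σ) (c τ • eZ) eZ
        calc ∫ x, ⟪u τ x, fderiv ℝ (heatTest 1 ψ σ) x eZ⟫
            = ∫ x, (⟪w τ x, fderiv ℝ (heatTest 1 ψ σ) x eZ⟫ + ⟪c τ • eZ, fderiv ℝ (heatTest 1 ψ σ) x eZ⟫) :=
              integral_congr_ae (by filter_upwards [huw τ hτ] with x hx; rw [hx, inner_add_left])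
          _ = ∫ x, ⟪w τ x, fderiv ℝ (heatTest 1 ψ σ) x eZ⟫ := by rw [integral_add i1 i2, h0, add_zero]
      have hzero_u : ∀ n k, ∫ x, ⟪u τ x, fderiv ℝ (heatTest 1 (φs k) ((q n : ℝ) - τ)) x eZ⟫ = 0 :=
        fun n k => by rw [htrans _ (hφs k).1, hm0]
      have hall : ∀ n, ∫ x, ⟪u τ x, fderiv ℝ (heatTest 1 φ ((q n : ℝ) - τ)) x eZ⟫ = 0 := fun n =>
        integral_inner_fderiv_heatTest_eq_zero_of_dense (hmeas τ hτ) (hM τ hτ) hφs hdense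
          (by simpa using hσpos n) (hzero_u n) hφ hdivφ
      exact integral_inner_fderiv_eq_zero_of_tendsto (hmeas τ hτ) (hM τ hτ) hν hσpos hσ hφ hall
    · -- the a.e.-constant rational slices accumulate at `τ⁺`: `u τ` is itself a.e. constant
      push Not at hacc
      obtain ⟨ε, hε, hfar⟩ := hacc
      have hδ : 0 < min ε (-τ) := lt_min hε (by linarith)
      -- rationals `r n ∈ (τ, τ + min ε (-τ) / (n + 2))`
      have hr : ∀ n : ℕ, ∃ r : ℚ, τ < r ∧ (r : ℝ) < τ + min ε (-τ) / ((n : ℝ) + 2) := fun n =>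
        exists_rat_btwn (lt_add_of_pos_right τ (by positivity))
      choose r hτr hrδ using hr
      have hr0 : ∀ n, (r n : ℝ) < 0 := by
        intro n
        have h1 : min ε (-τ) / ((n : ℝ) + 2) ≤ min ε (-τ) / 2 :=
          div_le_div_of_nonneg_left hδ.le (by norm_num) (by linarith [(Nat.cast_nonneg n : (0 : ℝ) ≤ n)])
        have h2 : min ε (-τ) ≤ -τ := min_le_right _ _
        linarith [hrδ n]
      have hrε : ∀ n, (r n : ℝ) < τ + ε := by
        intro n
        have h1 : min ε (-τ) / ((n : ℝ) + 2) ≤ min ε (-τ) / 1 :=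
          div_le_div_of_nonneg_left hδ.le one_pos (by linarith [(Nat.cast_nonneg n : (0 : ℝ) ≤ n)])
        have h2 : min ε (-τ) ≤ ε := min_le_left _ _
        linarith [hrδ n]
      -- these slices are a.e. constant (the `r n` are not honest)
      have hrconst : ∀ n, ∃ κ : EuclideanSpace ℝ (Fin 3), u (r n) =ᵐ[volume] fun _ => κ := by
        intro n
        by_contra hne
        push Not at hne
        have hmem : r n ∈ H := ⟨hr0 n, fun κ => hne κ⟩
        linarith [hfar (r n) hmem (hτr n), hrε n]
      have hrt : Tendsto (fun n => (r n : ℝ)) atTop (𝓝[Iio 0] τ) := by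
        refine tendsto_nhdsWithin_iff.2 ⟨?_, Eventually.of_forall hr0⟩
        have hup : Tendsto (fun n : ℕ => τ + min ε (-τ) / ((n : ℝ) + 2)) atTop (𝓝 τ) := by
          have h1 : Tendsto (fun n : ℕ => min ε (-τ) / ((n : ℝ) + 2)) atTop (𝓝 0) := by
            have := (tendsto_one_div_add_atTop_nhds_zero_nat.comp (tendsto_add_atTop_nat 1)).const_mul (min ε (-τ))
            rw [mul_zero] at this
            refine this.congr fun n => ?_
            simp only [Function.comp_apply, Nat.cast_add, Nat.cast_one]
            ring
          simpa using h1.const_add τ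
        exact tendsto_of_tendsto_of_tendsto_of_le_of_le tendsto_const_nhds hup (fun n => (hτr n).le) fun n => (hrδ n).le
      have hpair0 : ∀ θ : EuclideanSpace ℝ (Fin 3) → EuclideanSpace ℝ (Fin 3),
          FunctionSpaces.IsTestFunctionOn (⊤ : Opens (EuclideanSpace ℝ (Fin 3))) θ → VectorCalculus.IsDivFree θ →
          ∫ x, ⟪u τ x, θ x⟫ = 0 := by
        intro θ hθ hdivθ
        have hθ1 : ContDiff ℝ 1 θ := hθ.contDiff.of_le (by exact_mod_cast le_top)
        have hcont := hu.continuousOn_integral_inner hν hmeas hθ hdivθ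
        have hlim : Tendsto (fun n => ∫ x, ⟪u (r n) x, θ x⟫) atTop (𝓝 (∫ x, ⟪u τ x, θ x⟫)) :=
          (hcont τ hτ).tendsto.comp hrt
        have hvals : ∀ n, ∫ x, ⟪u (r n) x, θ x⟫ = 0 := by
          intro n
          obtain ⟨κ, hκ⟩ := hrconst n
          rw [integral_congr_ae (show (fun x => ⟪u (r n) x, θ x⟫) =ᵐ[volume] fun x => ⟪κ, θ x⟫ by
            filter_upwards [hκ] with x hx; rw [hx])]
          exact integral_inner_const_eq_zero_of_isDivFree κ hθ1 hθ.hasCompactSupport hdivθ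
        exact tendsto_nhds_unique hlim (tendsto_const_nhds.congr fun n => (hvals n).symm)
      obtain ⟨κ, hκ⟩ := IsWeaklyDivFree.exists_ae_eq_const_of_norm_le_of_forall_integral_inner_eq_zero
        (hmeas τ hτ) (hM τ hτ) (hu.1.1 τ hτ) hpair0
      have hDi : Integrable fun x => fderiv ℝ φ x eZ :=
        ((hφ1.continuous_fderiv one_ne_zero).clm_apply continuous_const).integrable_of_hasCompactSupport
          (hφ.hasCompactSupport.fderiv_apply (𝕜 := ℝ) eZ)
      calc ∫ x, ⟪u τ x, fderiv ℝ φ x eZ⟫ = ∫ x, ⟪κ, fderiv ℝ φ x eZ⟫ :=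
            integral_congr_ae (by filter_upwards [hκ] with x hx; rw [hx])
        _ = ⟪κ, ∫ x, fderiv ℝ φ x eZ⟫ := integral_inner hDi κ
        _ = 0 := by rw [integral_fderiv_apply_eq_zero hφ1 hφ.hasCompactSupport eZ, inner_zero_right]
  -- (ix) the drift lemma: `ũ = w + ct e_z = u' + (ct - c) e_z` is a bounded ancient mild solution
  set d : ℝ → ℝ := fun τ => ct τ - c τ with hd_def
  have hd : ∃ D : ℝ, ∀ t < 0, |d t| ≤ D := ⟨M + M, fun t ht =>
    (abs_sub _ _).trans (add_le_add (hctb t) (hcb t ht))⟩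
  have hinv : ∀ᵐ τ ∂((volume : Measure ℝ).restrict (Iio 0)),
      d τ = 0 ∨ ∀ h : ℝ, (fun x => u' τ (x + h • eZ)) =ᵐ[volume] u' τ := by
    filter_upwards [ae_restrict_of_ae (s := Iio (0 : ℝ)) hct_on, ae_restrict_mem measurableSet_Iio] with τ hτG hτ0
    by_cases hmem : τ ∈ Gd
    · left
      show ct τ - c τ = 0
      rw [hτG hmem, sub_self]
    · right
      intro h
      have e1 : (fun x => u' τ (x + h • eZ)) =ᵐ[volume] fun x => u τ (x + h • eZ) :=
        (measurePreserving_add_right volume (h • eZ)).quasiMeasurePreserving.ae_eq (hu'u τ hτ0)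
      exact e1.trans ((hinv_off τ hτ0 hmem h).trans (hu'u τ hτ0).symm)
  have hsol := hu'sol.add_timeConst_smul_of_ae_invariant hu'meas eZ hd hinv
  have hũ_eq : (fun t x => u' t x + d t • eZ) = fun t x => w t x + ct t • eZ := by
    funext t x
    simp only [hu'_def, hd_def, sub_smul]
    abel
  rw [hũ_eq] at hsol
  -- (x) `ũ` is a bounded weak solution, axisymmetric and swirl-free a.e.
  have hũjoint : AEStronglyMeasurable (uncurry fun t x => w t x + ct t • eZ)
      ((volume : Measure (ℝ × EuclideanSpace ℝ (Fin 3))).restrict (Iio 0 ×ˢ univ)) :=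
    (hw.add ((hctm.comp measurable_fst).stronglyMeasurable.smul_const eZ)).aestronglyMeasurable
  have hũsl : ∀ t < 0, AEStronglyMeasurable (fun x => w t x + ct t • eZ) volume := fun t _ =>
    (hwm t).add aestronglyMeasurable_const
  have hũU : ∀ t < 0, (fun x => w t x + ct t • eZ) =ᵐ[volume] fun x => u t x + (ct t - c t) • eZ := fun t ht => by
    filter_upwards [hwu' t ht] with x hx
    rw [hx, sub_smul]
    abel
  exact ⟨fun t x => w t x + ct t • eZ, fun t => ct t - c t, hsol, hũjoint, hũsl, hũU⟩

end Bridge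

/-! ### The negated pair -/

section Neg

/-- The nontrivial hypotheses of a bounded-drift swirl pair for `−F` (the swirl equation is
linear in the scalar). [folklore] -/
theorem LRZPair.neg_hyps {τ : ℝ} {F : ℝ → EuclideanSpace ℝ (Fin 3) → ℝ}
    {V : ℝ → EuclideanSpace ℝ (Fin 3) → EuclideanSpace ℝ (Fin 3)}
    (hF : ∀ t < τ, ContDiff ℝ ∞ (F t))
    (hFd : ContinuousOn (fun p : ℝ × (EuclideanSpace ℝ (Fin 3)) => fderiv ℝ (F p.1) p.2) (Iio τ ×ˢ univ))
    (hFΔ : ContinuousOn (fun p : ℝ × (EuclideanSpace ℝ (Fin 3)) => (Δ (F p.1)) p.2) (Iio τ ×ˢ univ))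
    (heq : ∀ x, cylRadius x ≠ 0 → ∀ s t : ℝ, s ≤ t → t < τ →
      F t x - F s x = ∫ r in s..t, ((Δ (F r)) x - fderiv ℝ (F r) x (V r x) -
        2 / cylRadius x * partialDeriv (eR x) (F r) x)) :
    (∀ t < τ, ContDiff ℝ ∞ fun x => -F t x) ∧
    ContinuousOn (fun p : ℝ × (EuclideanSpace ℝ (Fin 3)) => fderiv ℝ (fun x => -F p.1 x) p.2) (Iio τ ×ˢ univ) ∧
    ContinuousOn (fun p : ℝ × (EuclideanSpace ℝ (Fin 3)) => (Δ fun x => -F p.1 x) p.2) (Iio τ ×ˢ univ) ∧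
    (∀ x, cylRadius x ≠ 0 → ∀ s t : ℝ, s ≤ t → t < τ →
      (-F t x) - (-F s x) = ∫ r in s..t, ((Δ fun y => -F r y) x -
        fderiv ℝ (fun y => -F r y) x (V r x) -
        2 / cylRadius x * partialDeriv (eR x) (fun y => -F r y) x)) := by
  have hneg : ∀ t, (fun x => -F t x) = -(F t) := fun t => rfl
  refine ⟨fun t ht => (hF t ht).neg, ?_, ?_, ?_⟩
  · have : (fun p : ℝ × (EuclideanSpace ℝ (Fin 3)) => fderiv ℝ (fun x => -F p.1 x) p.2) =
        fun p => -fderiv ℝ (F p.1) p.2 := funext fun p => fderiv_fun_neg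
    rw [this]
    exact hFd.neg
  · have : (fun p : ℝ × (EuclideanSpace ℝ (Fin 3)) => (Δ fun x => -F p.1 x) p.2) = fun p => -(Δ (F p.1)) p.2 :=
      funext fun p => by rw [hneg, InnerProductSpace.laplacian_neg]; rfl
    rw [this]
    exact hFΔ.neg
  · intro x hx s t hst ht
    have hint : (fun r => (Δ fun y => -F r y) x - fderiv ℝ (fun y => -F r y) x (V r x) -
        2 / cylRadius x * partialDeriv (eR x) (fun y => -F r y) x) =
        fun r => -((Δ (F r)) x - fderiv ℝ (F r) x (V r x) -
          2 / cylRadius x * partialDeriv (eR x) (F r) x) := by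
      funext r
      rw [partialDeriv_apply, partialDeriv_apply, hneg, InnerProductSpace.laplacian_neg, fderiv_neg]
      simp only [Pi.neg_apply, neg_apply]
      ring
    rw [hint, intervalIntegral.integral_neg, ← heq x hx s t hst ht]
    ring

end Neg

/-! ### From a.e. to everywhere for the continuous representative -/

section AEToAll

/-- An a.e.-in-time bound for a function continuous on `(−∞, 0)` holds at every `t < 0`.
[folklore] -/
theorem forall_Iio_le_of_ae {g : ℝ → ℝ} {c : ℝ} (hg : ContinuousOn g (Iio 0))
    (h : ∀ᵐ t ∂((volume : Measure ℝ).restrict (Iio 0)), g t ≤ c) : ∀ t < 0, g t ≤ c :=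
  fun t ht => SereginSverak2009.forall_le_of_ae_le_of_continuousOn (μ := (volume : Measure ℝ))
    isOpen_Iio hg continuousOn_const h t ht

end AEToAll

/-! ### Theorem 1.2 in KNSS's class of bounded weak solutions: the solution is swirl-free -/

section BoundedWeak

set_option maxHeartbeats 800000 in
-- the transfer of four a.e. hypotheses to the continuous representative is long but elementary
/-- **Lei–Ren–Zhang 2019, Theorem 1.2, for bounded weak solutions: under the rate condition the
swirl vanishes.** Let `u` be a bounded weak solution of Navier–Stokes (`ν = 1`) in `ℝ³ × (−∞, 0)`
(KNSS 2009, §4), axisymmetric as an `L^∞` function, with radial velocity `|u_r| ≤ M`, swirl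
`|Γ| ≤ C` and `|Γ² − L²| ≤ ε₀L²/r` for `r ≥ R₀` (all a.e.), where `C_Δ` bounds `|Δ(ξ∘r)|` and
`ε₀ ∈ (0, 1)` satisfies `ε₀(2C_S + C_S max(M,0) + C_Δ) < 1`. Then `Γ = 0` a.e. for a.e. `t < 0`.
Proof: steps 2–4 of the module docstring (KNSS §4 regularity; `L = 0` by
`LRZPair.eq_zero_of_vanish_far`; `L ≠ 0` contradicts `LRZPair.false_of_plateau` after the sign
selection `LRZPair.pos_or_neg_of_sq_ge` and the rescaling `LRZPair.rescale`). [cite: LeiRenZhang2019, Thm 1.2 (arXiv p. 4) and §4 (pp. 10–12)] -/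
theorem leiRenZhang2019_boundedWeak_swirl_free {M ε₀ CΔ : ℝ}
    (hCΔ : ∀ y, |(Δ fun w : EuclideanSpace ℝ (Fin 3) => xiCut (cylRadius w)) y| ≤ CΔ)
    (hε₀ : 0 < ε₀) (hε₁ : ε₀ < 1)
    (hsmall : ε₀ * (2 * smoothTransitionC2Bound + smoothTransitionC2Bound * max M 0 + CΔ) < 1)
    {u : ℝ → EuclideanSpace ℝ (Fin 3) → EuclideanSpace ℝ (Fin 3)}
    (hu : IsBoundedWeakNSSolutionOn (Iio 0) isOpen_Iio 1 u)
    (haxi : ∀ θ : ℝ, ∀ᵐ t ∂((volume : Measure ℝ).restrict (Iio 0)),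
      (fun x => u t (rotZ θ x)) =ᵐ[volume] fun x => rotZ θ (u t x))
    (hrad : ∀ᵐ t ∂((volume : Measure ℝ).restrict (Iio 0)), ∀ᵐ x ∂(volume : Measure (EuclideanSpace ℝ (Fin 3))),
      |⟪u t x, eR x⟫| ≤ M)
    (hswirl : ∃ C : ℝ, ∀ᵐ t ∂((volume : Measure ℝ).restrict (Iio 0)),
      ∀ᵐ x ∂(volume : Measure (EuclideanSpace ℝ (Fin 3))), |swirl (u t) x| ≤ C)
    (hrate : ∃ L R₀ : ℝ, ∀ᵐ t ∂((volume : Measure ℝ).restrict (Iio 0)),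
      ∀ᵐ x ∂(volume : Measure (EuclideanSpace ℝ (Fin 3))), R₀ ≤ cylRadius x →
        |swirl (u t) x ^ 2 - L ^ 2| ≤ ε₀ * L ^ 2 / cylRadius x) :
    ∀ᵐ t ∂((volume : Measure ℝ).restrict (Iio 0)), swirl (u t) =ᵐ[volume] (0 : EuclideanSpace ℝ (Fin 3) → ℝ) := by
  obtain ⟨U, β, hβm, ⟨Cβ, hCβ⟩, hUm, hrep, hsmooth, hdiv, haxiU, hbdU, hlip, hswirlEq⟩ :=
    KNSS2009_regularity_axisymmetric_swirl_holds hu haxi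
  obtain ⟨C, hC⟩ := hswirl
  obtain ⟨L, R₀, hLR⟩ := hrate
  obtain ⟨C₀, hC₀⟩ := hbdU 0
  have hCS := smoothTransitionC2Bound_nonneg
  have hCΔ0 : 0 ≤ CΔ := (abs_nonneg _).trans (hCΔ 0)
  set Mp : ℝ := max M 0 with hMp
  have hMp0 : 0 ≤ Mp := le_max_right _ _
  have hMMp : M ≤ Mp := le_max_left _ _
  set S : Set (ℝ × EuclideanSpace ℝ (Fin 3)) := Iio 0 ×ˢ univ with hS
  -- smoothness of the slices in the degrees used below
  have hU2 : ∀ t < 0, ContDiff ℝ 2 (U t) := fun t ht => (hsmooth t ht).of_le (by norm_cast)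
  have hU1 : ∀ t < 0, ContDiff ℝ 1 (U t) := fun t ht => (hsmooth t ht).of_le (by norm_cast)
  have hUd : ∀ t < 0, ∀ x, DifferentiableAt ℝ (U t) x := fun t ht x =>
    ((hU1 t ht).differentiable one_ne_zero) x
  have hUb : ∀ t < 0, ∀ x, ‖U t x‖ ≤ C₀ := fun t ht x => by
    have h := hC₀ t ht x
    rwa [norm_iteratedFDeriv_zero] at h
  have hC₀0 : 0 ≤ C₀ := (norm_nonneg _).trans (hUb (-1) (by norm_num) 0)
  -- (4.8) ⇒ joint continuity of `U`, `∇U`, `∇²U`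
  have hD : ∀ k : ℕ, ContinuousOn (fun p : ℝ × EuclideanSpace ℝ (Fin 3) => iteratedFDeriv ℝ k (U p.1) p.2) S := by
    intro k
    obtain ⟨Lk, hLk⟩ := hlip k
    exact continuousOn_iteratedFDeriv_of_lipschitz hsmooth hLk
  have hUc : ContinuousOn (fun p : ℝ × EuclideanSpace ℝ (Fin 3) => U p.1 p.2) S := by
    have h := (ContinuousMultilinearMap.apply ℝ (fun _ : Fin 0 => EuclideanSpace ℝ (Fin 3)) (EuclideanSpace ℝ (Fin 3))
      (Fin.elim0 : Fin 0 → EuclideanSpace ℝ (Fin 3))).continuous.comp_continuousOn (hD 0)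
    refine h.congr fun p _ => ?_
    simp only [comp_apply, ContinuousMultilinearMap.apply_apply, iteratedFDeriv_zero_apply]
  have hD1c : ∀ y : EuclideanSpace ℝ (Fin 3), ContinuousOn (fun p : ℝ × EuclideanSpace ℝ (Fin 3) => fderiv ℝ (U p.1) p.2 y) S := by
    intro y
    have h := (ContinuousMultilinearMap.apply ℝ (fun _ : Fin 1 => EuclideanSpace ℝ (Fin 3)) (EuclideanSpace ℝ (Fin 3))
      (fun _ => y)).continuous.comp_continuousOn (hD 1)
    refine h.congr fun p _ => ?_
    simp only [comp_apply, ContinuousMultilinearMap.apply_apply, iteratedFDeriv_one_apply]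
  have hD2c : ∀ m : Fin 2 → EuclideanSpace ℝ (Fin 3),
      ContinuousOn (fun p : ℝ × EuclideanSpace ℝ (Fin 3) => iteratedFDeriv ℝ 2 (U p.1) p.2 m) S := fun m =>
    (ContinuousMultilinearMap.apply ℝ (fun _ : Fin 2 => EuclideanSpace ℝ (Fin 3)) (EuclideanSpace ℝ (Fin 3)) m).continuous.comp_continuousOn
      (hD 2)
  -- continuity in time of `U(·, x)` for a fixed `x`
  have hUt : ∀ x, ContinuousOn (fun s : ℝ => U s x) (Iio 0) := by
    intro x
    have hc : Continuous fun s : ℝ => ((s, x) : ℝ × EuclideanSpace ℝ (Fin 3)) := by fun_prop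
    exact hUc.comp hc.continuousOn fun s hs => ⟨hs, mem_univ _⟩
  have hΓt : ∀ x, ContinuousOn (fun s : ℝ => swirl (U s) x) (Iio 0) := by
    intro x
    simp only [swirl]
    exact ((continuousOn_const.mul ((PiLp.continuous_apply 2 _ 1).comp_continuousOn (hUt x))).sub
      (continuousOn_const.mul ((PiLp.continuous_apply 2 _ 0).comp_continuousOn (hUt x))))
  have hΓxc : ∀ t < 0, Continuous (swirl (U t)) := fun t ht => (contDiff_swirl (hU1 t ht)).continuous
  -- the twelve hypotheses of a bounded-drift swirl pair for `(Γ, U + β e_z)` on `t < 0`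
  have p1 : ∀ t < 0, ContDiff ℝ ∞ (fun x => swirl (U t) x) := fun t ht => contDiff_swirl (hsmooth t ht)
  have p2 : ContinuousOn (fun p : ℝ × EuclideanSpace ℝ (Fin 3) => fderiv ℝ (fun x => swirl (U p.1) x) p.2) S := by
    refine continuousOn_clm_apply.2 fun y => ?_
    have hG : ContinuousOn
        (fun p : ℝ × EuclideanSpace ℝ (Fin 3) => ⟪rotGen p.2, fderiv ℝ (U p.1) p.2 y⟫ + ⟪rotGen y, U p.1 p.2⟫) S :=
      ((rotGenL.continuous.comp continuous_snd).continuousOn.inner (hD1c y)).add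
        (continuousOn_const.inner hUc)
    refine hG.congr fun p hp => ?_
    exact fderiv_swirl_apply (hUd p.1 hp.1 p.2) y
  have p3 : ContinuousOn (fun p : ℝ × EuclideanSpace ℝ (Fin 3) => (Δ fun x => swirl (U p.1) x) p.2) S := by
    classical
    set b := EuclideanSpace.basisFun (Fin 3) ℝ with hb
    have hΔU : ContinuousOn (fun p : ℝ × EuclideanSpace ℝ (Fin 3) => (Δ (U p.1)) p.2) S := by
      have h : ContinuousOn
          (fun p : ℝ × EuclideanSpace ℝ (Fin 3) => ∑ i, iteratedFDeriv ℝ 2 (U p.1) p.2 ![b i, b i]) S :=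
        continuousOn_finsetSum _ fun i _ => hD2c _
      refine h.congr fun p _ => ?_
      exact congrFun (laplacian_eq_iteratedFDeriv_orthonormalBasis (U p.1) b) p.2
    have hG : ContinuousOn (fun p : ℝ × EuclideanSpace ℝ (Fin 3) => ⟪rotGen p.2, (Δ (U p.1)) p.2⟫ +
        2 * (fderiv ℝ (U p.1) p.2 (EuclideanSpace.single 0 1) 1 -
          fderiv ℝ (U p.1) p.2 (EuclideanSpace.single 1 1) 0)) S :=
      ((rotGenL.continuous.comp continuous_snd).continuousOn.inner hΔU).add
        (continuousOn_const.mul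
          (((PiLp.continuous_apply 2 _ 1).comp_continuousOn (hD1c _)).sub
            ((PiLp.continuous_apply 2 _ 0).comp_continuousOn (hD1c _))))
    refine hG.congr fun p hp => ?_
    exact laplacian_swirl (hU2 p.1 hp.1) p.2
  have p4 : ∀ t < 0, IsAxisymmetricScalar (fun x => swirl (U t) x) := fun t ht =>
    (haxiU t ht).isAxisymmetricScalar_swirl
  have p5 : ∀ t < 0, ∀ x, cylRadius x = 0 → (fun x => swirl (U t) x) x = 0 := fun t _ x hx =>
    swirl_eq_zero_of_cylRadius_eq_zero _ hx
  have p7 : Measurable (uncurry fun t x => U t x + β t • eZ) := by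
    show Measurable fun p : ℝ × EuclideanSpace ℝ (Fin 3) => U p.1 p.2 + β p.1 • eZ
    exact hUm.add ((hβm.comp measurable_fst).smul_const eZ)
  have p8 : ∀ t < 0, ContDiff ℝ ∞ (fun x => U t x + β t • eZ) := fun t ht => (hsmooth t ht).add contDiff_const
  have p9 : ∀ t < 0, VectorCalculus.IsDivFree (fun x => U t x + β t • eZ) := by
    intro t ht x
    have hfd : fderiv ℝ (fun y => U t y + β t • eZ) x = fderiv ℝ (U t) x := fderiv_add_const _
    simp only [VectorCalculus.divergence, hfd]
    exact hdiv t ht x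
  have p10 : ∀ t < 0, ∀ x, ‖U t x + β t • eZ‖ ≤ C₀ + Cβ := by
    intro t ht x
    refine (norm_add_le _ _).trans (add_le_add (hUb t ht x) ?_)
    rw [norm_smul, Real.norm_eq_abs]
    have : ‖(eZ : EuclideanSpace ℝ (Fin 3))‖ = 1 := by simp [eZ]
    rw [this, mul_one]
    exact hCβ t
  -- transfer of the hypotheses on `u` to the representative: for a.e. `t`, `swirl (U t) = swirl (u t)` a.e.
  have hΓae : ∀ᵐ t ∂((volume : Measure ℝ).restrict (Iio 0)), ∀ᵐ x ∂(volume : Measure (EuclideanSpace ℝ (Fin 3))),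
      swirl (U t) x = swirl (u t) x ∧ ⟪U t x, eR x⟫ = ⟪u t x, eR x⟫ := by
    filter_upwards [hrep] with t ht
    filter_upwards [ht] with x hx
    constructor
    · simp [swirl, hx, eZ]
    · rw [hx, inner_add_left, real_inner_smul_left, real_inner_comm (eR x) eZ, inner_eR_eZ, mul_zero, add_zero]
  -- (p6) the swirl bound everywhere
  have p6 : ∀ t < 0, ∀ x, |swirl (U t) x| ≤ C := by
    have hae : ∀ᵐ t ∂((volume : Measure ℝ).restrict (Iio 0)), ∀ x, |swirl (U t) x| ≤ C := by
      filter_upwards [hΓae, hC, ae_restrict_mem measurableSet_Iio] with t ht hCt htneg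
      have h1 : ∀ᵐ x ∂(volume : Measure (EuclideanSpace ℝ (Fin 3))), |swirl (U t) x| ≤ C := by
        filter_upwards [ht, hCt] with x hx hCx
        rw [hx.1]; exact hCx
      have h := SereginSverak2009.forall_le_of_ae_le_of_continuousOn isOpen_univ
        ((hΓxc t htneg).abs.continuousOn) continuousOn_const (by rwa [Measure.restrict_univ])
      exact fun x => h x (mem_univ x)
    intro t ht x
    refine forall_Iio_le_of_ae ((hΓt x).abs) ?_ t ht
    filter_upwards [hae] with s hs
    exact hs x
  -- (p11) the radial drift bound everywhere
  have p11 : ∀ t < 0, ∀ x, |⟪U t x + β t • eZ, eR x⟫| ≤ Mp := by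
    have hae : ∀ᵐ t ∂((volume : Measure ℝ).restrict (Iio 0)), ∀ x, |⟪U t x, eR x⟫| ≤ Mp := by
      filter_upwards [hΓae, hrad, ae_restrict_mem measurableSet_Iio] with t ht hMt htneg
      have h1 : ∀ᵐ x ∂(volume : Measure (EuclideanSpace ℝ (Fin 3))), |⟪U t x, eR x⟫| ≤ Mp := by
        filter_upwards [ht, hMt] with x hx hMx
        rw [hx.2]; exact hMx.trans hMMp
      -- off the axis both sides are continuous
      have hopen : IsOpen {y : EuclideanSpace ℝ (Fin 3) | cylRadius y ≠ 0} :=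
        isOpen_ne_fun continuous_cylRadius continuous_const
      -- `e_r` is continuous off the axis (cf. `SereginZajaczkowski2007.continuousOn_eR`)
      have heRc : ContinuousOn eR {y : EuclideanSpace ℝ (Fin 3) | cylRadius y ≠ 0} := by
        have h1 : ContinuousOn (fun y : EuclideanSpace ℝ (Fin 3) => (cylRadius y)⁻¹) {y | cylRadius y ≠ 0} :=
          continuous_cylRadius.continuousOn.inv₀ fun y hy => hy
        have h2 : Continuous fun y : EuclideanSpace ℝ (Fin 3) =>
            (toLp 2 ![y 0, y 1, 0] : EuclideanSpace ℝ (Fin 3)) := by fun_prop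
        exact h1.smul h2.continuousOn
      have hcont : ContinuousOn (fun y => |⟪U t y, eR y⟫|) {y : EuclideanSpace ℝ (Fin 3) | cylRadius y ≠ 0} :=
        ((hsmooth t htneg).continuous.continuousOn.inner heRc).abs
      have h := SereginSverak2009.forall_le_of_ae_le_of_continuousOn hopen hcont continuousOn_const
        (ae_restrict_of_ae h1)
      intro x
      by_cases hx0 : cylRadius x = 0
      · have : eR x = 0 := by simp [eR, hx0]
        rw [this, inner_zero_right, abs_zero]; exact hMp0
      · exact h x hx0
    intro t ht x
    have hcont : ContinuousOn (fun s : ℝ => |⟪U s x, eR x⟫|) (Iio 0) := ((hUt x).inner continuousOn_const).abs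
    have h := forall_Iio_le_of_ae hcont (by filter_upwards [hae] with s hs; exact hs x) t ht
    rw [inner_add_left, real_inner_smul_left, real_inner_comm (eR x) eZ, inner_eR_eZ, mul_zero, add_zero]
    exact h
  -- the rate condition everywhere on `{r > R₁}`, `R₁ = max R₀ 1`
  set R₁ : ℝ := max R₀ 1 with hR₁
  have hR₁1 : 1 ≤ R₁ := le_max_right _ _
  have hrateU : ∀ t < 0, ∀ x, R₁ < cylRadius x →
      |swirl (U t) x ^ 2 - L ^ 2| ≤ ε₀ * L ^ 2 / cylRadius x := by
    have hopen : IsOpen {y : EuclideanSpace ℝ (Fin 3) | R₁ < cylRadius y} := isOpen_lt continuous_const continuous_cylRadius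
    have hae : ∀ᵐ t ∂((volume : Measure ℝ).restrict (Iio 0)), ∀ x, R₁ < cylRadius x →
        |swirl (U t) x ^ 2 - L ^ 2| ≤ ε₀ * L ^ 2 / cylRadius x := by
      filter_upwards [hΓae, hLR, ae_restrict_mem measurableSet_Iio] with t ht hLt htneg
      have h1 : ∀ᵐ x ∂(volume : Measure (EuclideanSpace ℝ (Fin 3))), x ∈ {y : EuclideanSpace ℝ (Fin 3) | R₁ < cylRadius y} →
          |swirl (U t) x ^ 2 - L ^ 2| ≤ ε₀ * L ^ 2 / cylRadius x := by
        filter_upwards [ht, hLt] with x hx hLx hmem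
        rw [hx.1]
        exact hLx ((le_max_left _ _).trans (le_of_lt hmem))
      have hcont1 : ContinuousOn (fun y => |swirl (U t) y ^ 2 - L ^ 2|) {y : EuclideanSpace ℝ (Fin 3) | R₁ < cylRadius y} :=
        ((((hΓxc t htneg).pow 2).sub continuous_const).abs).continuousOn
      have hcont2 : ContinuousOn (fun y => ε₀ * L ^ 2 / cylRadius y) {y : EuclideanSpace ℝ (Fin 3) | R₁ < cylRadius y} :=
        continuousOn_const.div continuous_cylRadius.continuousOn fun y hy => by
          have : (1 : ℝ) ≤ cylRadius y := hR₁1.trans (le_of_lt hy)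
          exact ne_of_gt (one_pos.trans_le this)
      exact SereginSverak2009.forall_le_of_ae_le_of_continuousOn hopen hcont1 hcont2 ((ae_restrict_iff' hopen.measurableSet).2 h1)
    intro t ht x hx
    have hcont : ContinuousOn (fun s : ℝ => |swirl (U s) x ^ 2 - L ^ 2|) (Iio 0) := (((hΓt x).pow 2).sub continuousOn_const).abs
    exact forall_Iio_le_of_ae hcont (by filter_upwards [hae] with s hs; exact hs x hx) t ht
  -- joint continuity of `Γ`
  have hFc : ContinuousOn (uncurry fun t x => swirl (U t) x) S := LRZPair.continuousOn_uncurry p1 p2 p5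
  -- `Γ ≡ 0`
  have hzero : ∀ t < 0, ∀ x, swirl (U t) x = 0 := by
    by_cases hL : L = 0
    · -- the case `L = 0`: `Γ = 0` beyond `R₁`, hence everywhere (Lemma 2.1)
      have hfar : ∀ t < 0, ∀ x, R₁ + 1 ≤ cylRadius x → (fun x => swirl (U t) x) x = 0 := by
        intro t ht x hx
        have h := hrateU t ht x (by linarith)
        rw [hL] at h
        simp only [ne_eq, OfNat.ofNat_ne_zero, not_false_eq_true, zero_pow, sub_zero, mul_zero, zero_div,
          abs_nonpos_iff] at h
        exact pow_eq_zero_iff (n := 2) two_ne_zero |>.1 h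
      have hK : ∀ t < 0, ∀ x, |(fun x => swirl (U t) x) x| ≤ C₀ * cylRadius x := by
        intro t ht x
        calc |swirl (U t) x| ≤ cylRadius x * ‖U t x‖ := abs_swirl_le_cylRadius_mul_norm (U t) x
          _ ≤ cylRadius x * C₀ := mul_le_mul_of_nonneg_left (hUb t ht x) (cylRadius_nonneg x)
          _ = C₀ * cylRadius x := mul_comm _ _
      exact LRZPair.eq_zero_of_vanish_far p1 p2 p3 p4 p5 p6 p7 p8 p9 p10 hswirlEq hK hfar
    · -- the case `L ≠ 0` is impossible
      exfalso
      set Λ₀ : ℝ := |L| with hΛ₀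
      have hΛ₀pos : 0 < Λ₀ := abs_pos.2 hL
      have hΛ₀sq : Λ₀ ^ 2 = L ^ 2 := sq_abs L
      set R₂ : ℝ := R₁ + 2 with hR₂
      have hR₂1 : 1 ≤ R₂ := by linarith
      have hR₂pos : 0 < R₂ := by linarith
      -- the rate condition with `Λ₀` on `{r ≥ R₂}` and the lower bound `Γ² ≥ Λ₀²/2`
      have hrate2 : ∀ t < 0, ∀ x, R₂ ≤ cylRadius x →
          |swirl (U t) x ^ 2 - Λ₀ ^ 2| ≤ ε₀ * Λ₀ ^ 2 / cylRadius x := by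
        intro t ht x hx
        rw [hΛ₀sq]
        exact hrateU t ht x (by linarith)
      have hsq : ∀ t < 0, ∀ x, R₂ ≤ cylRadius x → Λ₀ ^ 2 / 2 ≤ (fun t x => swirl (U t) x) t x ^ 2 := by
        intro t ht x hx
        have h := hrate2 t ht x hx
        have hr2 : 2 ≤ cylRadius x := by linarith
        have hr0 : 0 < cylRadius x := by linarith
        have h1 : ε₀ * Λ₀ ^ 2 / cylRadius x ≤ Λ₀ ^ 2 / 2 := by
          rw [div_le_div_iff₀ hr0 two_pos]
          nlinarith [sq_nonneg Λ₀, mul_nonneg (sq_nonneg Λ₀) (sub_nonneg.2 hr2)]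
        have h2 := (abs_le.1 (h.trans h1)).1
        show Λ₀ ^ 2 / 2 ≤ swirl (U t) x ^ 2
        linarith
      -- the sign of `Γ` on `{r ≥ R₂}`
      have hsign := LRZPair.pos_or_neg_of_sq_ge (F := fun t x => swirl (U t) x) hFc p4 (by positivity) hsq
      -- the common end of the argument, for `G = ±Γ`
      have main : ∀ G : ℝ → EuclideanSpace ℝ (Fin 3) → ℝ,
          (∀ t < 0, ContDiff ℝ ∞ (G t)) →
          ContinuousOn (fun p : ℝ × EuclideanSpace ℝ (Fin 3) => fderiv ℝ (G p.1) p.2) S →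
          ContinuousOn (fun p : ℝ × EuclideanSpace ℝ (Fin 3) => (Δ (G p.1)) p.2) S →
          (∀ t < 0, IsAxisymmetricScalar (G t)) →
          (∀ t < 0, ∀ x, cylRadius x = 0 → G t x = 0) →
          (∀ t < 0, ∀ x, |G t x| ≤ C) →
          (∀ x, cylRadius x ≠ 0 → ∀ s t : ℝ, s ≤ t → t < 0 →
            G t x - G s x = ∫ r in s..t, ((Δ (G r)) x - fderiv ℝ (G r) x (U r x + β r • eZ) -
              2 / cylRadius x * partialDeriv (eR x) (G r) x)) →
          (∀ t < 0, ∀ x, R₂ ≤ cylRadius x → 0 < G t x) →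
          (∀ t < 0, ∀ x, R₂ ≤ cylRadius x → |G t x ^ 2 - Λ₀ ^ 2| ≤ ε₀ * Λ₀ ^ 2 / cylRadius x) → False := by
        intro G g1 g2 g3 g4 g5 g6 g12 gpos grate
        -- the plateau `|G − Λ₀| ≤ ε₀ Λ₀ / r` on `{r ≥ R₂}`
        have gpl : ∀ t < 0, ∀ x, R₂ ≤ cylRadius x → |G t x - Λ₀| ≤ ε₀ * Λ₀ / cylRadius x := by
          intro t ht x hx
          have hG := gpos t ht x hx
          have h := grate t ht x hx
          have hr0 : 0 < cylRadius x := hR₂pos.trans_le hx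
          have hsum : 0 < G t x + Λ₀ := by linarith
          have e : |G t x ^ 2 - Λ₀ ^ 2| = |G t x - Λ₀| * (G t x + Λ₀) := by
            rw [show G t x ^ 2 - Λ₀ ^ 2 = (G t x - Λ₀) * (G t x + Λ₀) by ring, abs_mul, abs_of_pos hsum]
          rw [e] at h
          rw [le_div_iff₀ hr0]
          have h' : |G t x - Λ₀| * (G t x + Λ₀) * cylRadius x ≤ ε₀ * Λ₀ ^ 2 := by
            have := mul_le_mul_of_nonneg_right h hr0.le
            rwa [div_mul_cancel₀ _ hr0.ne'] at this
          nlinarith [abs_nonneg (G t x - Λ₀), mul_nonneg (mul_nonneg (abs_nonneg (G t x - Λ₀)) hG.le) hr0.le]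
        -- rescale by `λ = R₂`
        have gVr : ∀ t < 0, ∀ x, |⟪U t x + β t • eZ, eR x⟫| ≤ Mp := p11
        obtain ⟨hF', hFd', hFΔ', hFa', hF0', hFb', hVm', hVs', hVdiv', hVb', hVr', heq'⟩ :=
          LRZPair.rescale g1 g2 g3 g4 g5 g6 p7 p8 p9 p10 gVr g12 hR₂pos (-1) 0 0
        set τ' : ℝ := 0 + (0 - (-1)) / R₂ ^ 2 with hτ'
        have hpl' : ∀ s < τ', ∀ y, 1 ≤ cylRadius y → cylRadius y ≤ 2 →
            |stPull (R₂ ^ 2) R₂ (-1 - R₂ ^ 2 * 0) ((0 : ℝ) • eZ) G s y - Λ₀| ≤ ε₀ * Λ₀ / R₂ := by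
          intro s hs y h1 h2
          rw [stPull_rescale_apply]
          have htime : -1 + R₂ ^ 2 * (s - 0) < 0 := by
            have h' : s < 1 / R₂ ^ 2 := by rw [hτ'] at hs; simpa using hs
            have := (lt_div_iff₀ (by positivity : (0 : ℝ) < R₂ ^ 2)).1 h'
            nlinarith
          have hX : cylRadius ((0 : ℝ) • eZ + R₂ • y) = R₂ * cylRadius y := by
            rw [cylRadius_smul_eZ_add_smul, abs_of_pos hR₂pos]
          have hXge : R₂ ≤ cylRadius ((0 : ℝ) • eZ + R₂ • y) := by rw [hX]; nlinarith
          have h := gpl _ htime _ hXge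
          rw [hX] at h
          refine h.trans ?_
          rw [div_le_div_iff₀ (by positivity) hR₂pos]
          have : 0 ≤ ε₀ * Λ₀ := by positivity
          nlinarith
        -- the smallness condition of `false_of_plateau`
        have hsmall' : ε₀ * Λ₀ / R₂ * (2 * smoothTransitionC2Bound + smoothTransitionC2Bound * (R₂ * Mp) + CΔ) < Λ₀ := by
          have h1 : ε₀ * Λ₀ / R₂ * (2 * smoothTransitionC2Bound + smoothTransitionC2Bound * (R₂ * Mp) + CΔ) =
              Λ₀ * (ε₀ * (2 * smoothTransitionC2Bound / R₂ + smoothTransitionC2Bound * Mp + CΔ / R₂)) := by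
            field_simp
          have h2 : 2 * smoothTransitionC2Bound / R₂ ≤ 2 * smoothTransitionC2Bound := by
            rw [div_le_iff₀ hR₂pos]; nlinarith
          have h3 : CΔ / R₂ ≤ CΔ := by rw [div_le_iff₀ hR₂pos]; nlinarith
          have h4 : ε₀ * (2 * smoothTransitionC2Bound / R₂ + smoothTransitionC2Bound * Mp + CΔ / R₂) < 1 := by
            calc _ ≤ ε₀ * (2 * smoothTransitionC2Bound + smoothTransitionC2Bound * Mp + CΔ) := by
                  refine mul_le_mul_of_nonneg_left ?_ hε₀.le; linarith
              _ < 1 := hsmall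
          rw [h1]
          nlinarith
        exact LRZPair.false_of_plateau hF' hFd' hFΔ' hFa' hF0' hFb' hVm' hVs' hVdiv' hVb' hVr' heq' hΛ₀pos
          (by positivity) hpl' hCΔ hsmall'
      rcases hsign with hposG | hnegG
      · exact main (fun t x => swirl (U t) x) p1 p2 p3 p4 p5 p6 hswirlEq hposG hrate2
      · obtain ⟨n1, n2, n3, n12⟩ := LRZPair.neg_hyps (V := fun t x => U t x + β t • eZ) p1 p2 p3 hswirlEq
        refine main (fun t x => -swirl (U t) x) n1 n2 n3 (fun t ht θ x => by simp only [p4 t ht θ x])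
          (fun t ht x hx => by simp only [p5 t ht x hx, neg_zero])
          (fun t ht x => by rw [abs_neg]; exact p6 t ht x) n12
          (fun t ht x hx => by linarith [hnegG t ht x hx]) (fun t ht x hx => by rw [neg_sq]; exact hrate2 t ht x hx)
  -- transfer to `u = U + β e_z` (a.e.)
  filter_upwards [hrep, ae_restrict_mem measurableSet_Iio] with t ht htneg
  filter_upwards [ht] with x hx
  have h0 := hzero t htneg x
  rw [Pi.zero_apply, show swirl (u t) x = swirl (fun y => U t y + β t • eZ) x by
    simp only [swirl, hx], swirl_add_smul_eZ]
  exact h0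

end BoundedWeak

/-! ### The discharge -/

section Discharge

/-- **Lei–Ren–Zhang 2019, Theorem 1.2, PROVED** (the named fact
`leiRenZhang2019_liouville_swirl_rate` of `SelfSimilarLiouville`): for every bound `M` there is
`ε₀ ∈ (0, 1)` — here `ε₀ = 1/(2C_S + C_S |M| + C_Δ + 2)` with the universal cut-off constants
`C_S = smoothTransitionC2Bound` and `C_Δ = sup |Δ(ξ∘r)|` — such that every bounded ancient mild
solution `u` (`ν = 1`, duality form) with `‖u‖ ≤ M`, measurable axisymmetric slices, bounded swirl
and the rate condition `|Γ² − L²| ≤ ε₀ L²/r` for `r ≥ R₀` is, on every slice `t < 0`, a.e. an axial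
constant `β e_z`. Proof: the module docstring (class bridge, KNSS §4 regularity,
`leiRenZhang2019_boundedWeak_swirl_free`, KNSS Theorem 5.2, every slice). [cite: LeiRenZhang2019, Thm 1.2 (arXiv p. 4) and §4 (pp. 10–12)] -/
theorem leiRenZhang2019_liouville_swirl_rate_holds : leiRenZhang2019_liouville_swirl_rate := by
  intro M
  obtain ⟨CΔ, hCΔ0, hCΔ⟩ := LRZPair.exists_bound_laplacian_xiCut_cylRadius
  have hCS := smoothTransitionC2Bound_nonneg
  set D : ℝ := 2 * smoothTransitionC2Bound + smoothTransitionC2Bound * |M| + CΔ + 2 with hD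
  have hD2 : 2 ≤ D := by
    have : 0 ≤ 2 * smoothTransitionC2Bound + smoothTransitionC2Bound * |M| + CΔ := by positivity
    rw [hD]; linarith
  have hDpos : 0 < D := by linarith
  refine ⟨1 / D, ⟨by positivity, by rw [div_lt_one hDpos]; linarith⟩, ?_⟩
  intro u hu hM hmeas haxi hswirl hrate t₀ ht₀
  have hν : (0 : ℝ) < 1 := one_pos
  -- the class bridge
  obtain ⟨ũ, e, hũsol, hũjoint, hũsl, hũU⟩ := exists_jointly_measurable_axial_modification hu hmeas haxi
  have hweak : IsBoundedWeakNSSolutionOn (Iio 0) isOpen_Iio 1 ũ := hũsol.isBoundedWeakNSSolutionOn hν hũjoint hũsl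
  have haxiU : ∀ t < 0, IsAxisymmetric fun x => u t x + e t • eZ := fun t ht => isAxisymmetric_add_smul_eZ (haxi t ht) _
  have hax : ∀ θ : ℝ, ∀ᵐ t ∂((volume : Measure ℝ).restrict (Iio 0)),
      (fun x => ũ t (rotZ θ x)) =ᵐ[volume] fun x => rotZ θ (ũ t x) := by
    intro θ
    filter_upwards [ae_restrict_mem measurableSet_Iio] with t ht
    have e1 : (fun x => ũ t (rotZ θ x)) =ᵐ[volume] fun x => u t (rotZ θ x) + e t • eZ :=
      (measurePreserving_rotZ θ).quasiMeasurePreserving.ae (hũU t ht)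
    have e2 : (fun x => rotZ θ (ũ t x)) =ᵐ[volume] fun x => rotZ θ (u t x + e t • eZ) := by
      filter_upwards [hũU t ht] with x hx
      simp only [hx]
    have e3 : (fun x => u t (rotZ θ x) + e t • eZ) =ᵐ[volume] fun x => rotZ θ (u t x + e t • eZ) :=
      Eventually.of_forall fun x => haxiU t ht θ x
    exact e1.trans (e3.trans e2.symm)
  -- the hypotheses of the bounded-weak theorem for `ũ`
  have hrad : ∀ᵐ t ∂((volume : Measure ℝ).restrict (Iio 0)), ∀ᵐ x ∂(volume : Measure (EuclideanSpace ℝ (Fin 3))),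
      |⟪ũ t x, eR x⟫| ≤ M := by
    filter_upwards [ae_restrict_mem measurableSet_Iio] with t ht
    filter_upwards [hũU t ht] with x hx
    rw [hx, inner_add_left, real_inner_smul_left, real_inner_comm (eR x) eZ, inner_eR_eZ, mul_zero, add_zero]
    exact (LRZPair.abs_inner_eR_le _ _).trans (hM t ht x)
  have hswirl' : ∃ C : ℝ, ∀ᵐ t ∂((volume : Measure ℝ).restrict (Iio 0)),
      ∀ᵐ x ∂(volume : Measure (EuclideanSpace ℝ (Fin 3))), |swirl (ũ t) x| ≤ C := by
    obtain ⟨C, hC⟩ := hswirl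
    refine ⟨C, ?_⟩
    filter_upwards [ae_restrict_mem measurableSet_Iio] with t ht
    filter_upwards [hũU t ht] with x hx
    rw [show swirl (ũ t) x = swirl (fun y => u t y + e t • eZ) x by simp only [swirl, hx], swirl_add_smul_eZ]
    exact hC t ht x
  have hrate' : ∃ L R₀ : ℝ, ∀ᵐ t ∂((volume : Measure ℝ).restrict (Iio 0)),
      ∀ᵐ x ∂(volume : Measure (EuclideanSpace ℝ (Fin 3))), R₀ ≤ cylRadius x →
        |swirl (ũ t) x ^ 2 - L ^ 2| ≤ 1 / D * L ^ 2 / cylRadius x := by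
    obtain ⟨L, R₀, hLR⟩ := hrate
    refine ⟨L, R₀, ?_⟩
    filter_upwards [ae_restrict_mem measurableSet_Iio] with t ht
    filter_upwards [hũU t ht] with x hx hRx
    rw [show swirl (ũ t) x = swirl (fun y => u t y + e t • eZ) x by simp only [swirl, hx], swirl_add_smul_eZ]
    exact hLR t ht x hRx
  have hsmall : 1 / D * (2 * smoothTransitionC2Bound + smoothTransitionC2Bound * max M 0 + CΔ) < 1 := by
    rw [div_mul_eq_mul_div, one_mul, div_lt_one hDpos, hD]
    have : max M 0 ≤ |M| := max_le (le_abs_self M) (abs_nonneg M)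
    nlinarith
  have hfree := leiRenZhang2019_boundedWeak_swirl_free hCΔ (by positivity) (by rw [div_lt_one hDpos]; linarith)
    hsmall hweak hax hrad hswirl' hrate'
  -- KNSS Theorem 5.2 for the swirl-free `ũ`
  obtain ⟨b, -, -, hb⟩ := KNSS2009_liouville_axisymmetric_no_swirl_holds hweak hax hfree
  -- the slices of `u` are a.e. constant for a.e. `t`, hence for every `t`
  have hconst : ∀ᵐ t ∂((volume : Measure ℝ).restrict (Iio 0)),
      u t =ᵐ[volume] fun _ => (b t - e t) • eZ := by
    filter_upwards [hb, ae_restrict_mem measurableSet_Iio] with t hbt ht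
    filter_upwards [hbt, hũU t ht] with x hx hx'
    have hx2 : u t x + e t • eZ = b t • eZ := by rw [← hx']; exact hx
    have e : u t x = (u t x + e t • eZ) - e t • eZ := by abel
    rw [e, hx2, sub_smul]
  obtain ⟨κ, hκ⟩ := hu.exists_ae_eq_const_slice hν hmeas hconst t₀ ht₀
  have hax' := eq_smul_eZ_of_ae_eq_const_of_isAxisymmetric (haxi t₀ ht₀) hκ
  refine ⟨κ 2, ?_⟩
  rw [hax'] at hκ
  exact hκ

end Discharge

end Literature.Analysis.FluidPDE

end
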